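import Summits.QuantumFields.BalabanUV.T4Continuum.Support.VariationalVectorWeitzenbock
import Summits.QuantumFields.BalabanUV.T4Continuum.Support.VariationalVectorPoincare

/-!
# T⁴ programme, spine node NE2 (U1a), lane P2 — LEAF V-P, THE GÅRDING HALF, file 2: (Går) `n^{−d}(n²·roughV R W) ≤ κ·ScV n M R G W + κ′·nsqV M (Q W)`
# READ OUT of the Weitzenböck inequality, a DISPLAYED divergence control (GF3) of the gauge functional and any rough Poincaré inequality;
# the `hPc` binder of `vector_pair_bracket_sqrt` assembled for the road's line-indexed average; the LANDAU gauge functional inhabits (GF3)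

NE2 formalisation swarm `b2b-balaban-t4-ne2-formalise-*`, leaf prover 09 GEN 6 (`prover-b2b-balaban-t4-ne2-formalise-leaf-09-g6-0`); journal INTENT
CLAIMS.log 2026-08-20 12:42Z «V-P PROPER = THE GÅRDING HALF».  On top of file 1 `VariationalVectorWeitzenbock` (`divSq`, `roughV_le_curl_div`,
`divSq_le_mul_roughV`, `continuous_divSq`) and of leaf-01-g5's V-P CORE (i) `VariationalVectorPoincare.{qWV_le_line_poincare, qWV_le_of_garding}` (p218347,
BY NAME: the rough form controls the `ℓ²` size modulo the line-sum average `QvL (lineT T′ R)`; «SO LEAF V-P = (Går)»).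

THE STATEMENT (model level; ONE level `n`, every torus `Tor M`; `E` a complex Hilbert space; physical units `n^{2−d}`).  Bond transports `R` UNITARY with
plaquette defect `‖R(x,μ)∘R(x+e_μ,ν) − R(x,ν)∘R(x+e_ν,μ)‖ ≤ p` (DATA); the road owner's form `ScV n M R G W = n^{−d}·(n²·(½·curlSq R W + G W))` (decision
(D2), `G` DATA with (GF0) `0 ≤ G`); an averaging `Q` to the unit lattice (ANY map in §1–§2).  The one hypothesis on `G` displayed here is
  (GF3)  `n^{−d}(n²·divSq R W) ≤ C_D·ScV n M R G W + C_D′·nsqV M (Q W)`   — «the gauge functional controls the covariant divergence modulo the form and the average».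
 * §1 **`garding_remainder`**: (GF0) + (GF3) ⟹ `n^{−d}(n²·roughV R W) ≤ (1 + C_D)·ScV W + C_D′·nsqV (Q W) + d·(n²p)·qWV W` (file 1's `roughV ≤ ½curl² + div² + d·p·Σ‖W‖²`);
 * §2 **`garding_of_poincare`** = (Går): adding ANY rough Poincaré inequality `qWV W ≤ A·nsqV (Q W) + B·n^{−d}(n²·roughV R W)` and the smallness
   `2·B·d·(n²p) ≤ 1` (the plaquette class `n²·p ≤ c` of the scalar END): `n^{−d}(n²·roughV) ≤ 2(1 + C_D)·ScV W + 2(C_D′ + d(n²p)A)·nsqV (Q W)`;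
   **`qWV_le_of_poincare_divControl`**: the `hPc` binder itself, `qWV W ≤ max(B·κ, A + B·κ′)·(ScV W + nsqV (Q W))`;
 * §3 **`qWV_le_line_of_divControl`** — THE ROAD's CASE: `Q = QvL n M (lineT T′ R)` with UNITARY site transports `T′` and the in-block defect
   `‖R(x,μ)∘T′(x+e_μ)⋆∘T′(x) − 1‖ ≤ w`, `2d(nw)² ≤ ½` (leaf-01-g5's ∕ leaf-02-g4's binders verbatim; A = 16, B = 20): (GF0) + (GF3) + `40·d·(n²p) ≤ 1` ⟹
   `qWV n M W ≤ max(40(1 + C_D), 16 + 40(C_D′ + 16·d·(n²p)))·(ScV n M R G W + nsqV M (QvL n M (lineT T′ R) W))` — LEAF V-P for the fixed form MODULO (GF3);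
 * §4 THE INHABITANT: the Landau∕penalty gauge functional **`landauG δ R W := δ⁻¹·divSq R W`** (the skeleton's own V-P wording «‖W‖² ≤ C_V(‖curl_U W‖² +
   δ⁻¹‖div_U W‖² + nsq(Q(U)W))», §2.E row V-P): (GF0) `landauG_nonneg`, continuity, (GF1) `landauG_le` (`≤ (d∕δ)·roughV + 0·nsqV`), (GF3) `divControl_landauG`
   with `C_D = δ`, `C_D′ = 0` for EVERY `Q`, monotonicity `divControl_mono` (any `G ≥ landauG δ R` pointwise inherits (GF3)); hence **`qWV_le_line_landau`**:
   LEAF V-P CLOSED for the form `ScV n M R (landauG δ R)` and the average `QvL (lineT T′ R)` — hypotheses = unitary `T′`, `R`, the in-block defect class, the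
   plaquette class `40·d·(n²p) ≤ 1`, `0 < δ`; constant `max(40(1 + δ), 16 + 640·d·(n²p))`.
HONEST about Bałaban's own gauge term: [B9] (3.26) `D_U R(U) D_U*` with `R(U)` built from the scalar Green's function is NOT the Landau functional; at `U = 1`
(`R = I − P`, [B5] (1.69)–(1.70)) (GF3) — indeed (Går) — is the tree's (1.90) `γ(Δ + I) ≤ Δ_a` (`B5DeltaA169`) read through (1.21), a matrix-world statement not
bridged here; `U ≠ 1` for Bałaban's `R(U)` is leaf V-GF ∕ P1's rows.  For `G = 0` (Går) is FALSE (leaf-01-g5's `VariationalVectorExterior.QvL_cDv_flat`).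
HONEST about what the Landau inhabitant does NOT give: (GF2) — the one-step consistency of `G` under the average (leaf V-GF, the `G`-half of the bracket's `hFED`) — is
NOT touched here, and for `landauG` under the line-sum average it is NOT expected in the bracket's additive shape with a small defect: the coarse divergence of
`QvL W′` is a sum over `μ` of averages of `D_μW′_μ` over `μ`-DEPENDENT windows, not an average of `div W′`, so a divergence-free `W′` has `div (Q₁W′) ≠ 0` in general
(located numerically at `U = 1`, `d = 2`, `L = 4`, unit coarse torus `4²`: `divSq (Q₁W′) ∕ qVV W′ ≈ 0.09` on a div-free mode; script `HOME/b2b-balaban-t4-ne2-formalise-leaf-09/g6/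
landau_gf2_test.py`; illustrative, one engine, not an input of any proof).  So `landauG` CLOSES LEAF V-P (this file) but is not offered as the `G` of the vector END; which `G`
satisfies (GF0)–(GF3) together — [B5]'s `R = I − P` is the printed candidate, its form reproducing itself under the k-fold step ((1.64)–(1.69)) — stays the road's V-GF item.

HONEST FRAMING (T4-DAG p. 1).  Model level; transports and `G` DATA (no identification with Bałaban's `U(Γ)` or `R(U)` — c5); [folklore] bookkeeping on top of file 1
and V-P CORE (i); nothing printed is a hypothesis; data `def` `landauG` only, no `def … : Prop`, no `sorry`; axioms standard.  V-P for the road's DATA `G` holds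
MODULO (GF3) (displayed); NE2 NOT proved; spine PROVED 0∕9 unchanged; rung (B)+1 finite T⁴ — NOT infinite volume, NOT mass gap, NOT Clay.  HONEST DEPENDENCY (cell,
verbatim): continuum YM on T⁴ ⇐ BetaPertH ∧ nine spine estimates (0/9 proved); BetaPertH ⇐ (D1) ∧ (D4) ∧ CAP+tail; G-an2-4 gates asym, D1 and NE2/3/4.
-/

noncomputable section

namespace Summit.QuantumFields.BalabanUV.T4Continuum.VariationalVectorGarding

open Finset
open Literature.MathematicalPhysics.QuantumFieldTheory.Balaban1983to89.B5Prop11Plancherel (Tor fine unitVec)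
open Literature.MathematicalPhysics.QuantumFieldTheory.Balaban1983to89.B5Blocks16 (blockOf)
open Summit.QuantumFields.BalabanUV.T4Continuum.VariationalColourBochner (opNorm_le_one_of_mem_unitary)
open Summit.QuantumFields.BalabanUV.T4Continuum.VectorBlockTrialForm (nsqV nsqV_nonneg QvL roughV roughV_nonneg)
open Summit.QuantumFields.BalabanUV.T4Continuum.VariationalVectorForm (curlSq curlSq_nonneg ScV ScV_nonneg qWV qWV_nonneg)
open Summit.QuantumFields.BalabanUV.T4Continuum.VariationalVectorFederbush (lineT)
open Summit.QuantumFields.BalabanUV.T4Continuum.VariationalVectorWeitzenbock (divSq divSq_nonneg continuous_divSq roughV_le_curl_div divSq_le_mul_roughV)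
open Summit.QuantumFields.BalabanUV.T4Continuum.VariationalVectorPoincare (qWV_le_line_poincare qWV_le_of_garding)

variable {d : ℕ} {E : Type*} [NormedAddCommGroup E] [InnerProductSpace ℂ E] [CompleteSpace E]
variable (n : ℕ) [NeZero n] (M : Fin d → ℕ) [hM : ∀ μ, NeZero (M μ)]

/-! ## §1 The Gårding inequality with the curvature remainder -/

omit [CompleteSpace E] in
/-- the curl half of the form: `n^{−d}(n²·curlSq∕2) ≤ ScV` under (GF0). [folklore] -/
theorem phys_curl_le_ScV (R : Tor (fine n M) → Fin d → (E →L[ℂ] E)) {G : (Tor (fine n M) → Fin d → E) → ℝ} (hG0 : ∀ W, 0 ≤ G W)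
    (W : Tor (fine n M) → Fin d → E) :
    ((n : ℝ) ^ d)⁻¹ * ((n : ℝ) ^ 2 * (curlSq (fine n M) R W / 2)) ≤ ScV n M R G W := by
  have := hG0 W
  unfold ScV; gcongr; linarith

omit [InnerProductSpace ℂ E] [CompleteSpace E] in
/-- physical units of the `ℓ²` size: `n^{−d}(n²·(c·nsqV W)) = (n²·c)·qWV W`. [folklore] -/
theorem phys_nsqV_eq (c : ℝ) (W : Tor (fine n M) → Fin d → E) :
    ((n : ℝ) ^ d)⁻¹ * ((n : ℝ) ^ 2 * (c * nsqV (fine n M) W)) = ((n : ℝ) ^ 2 * c) * qWV n M W := by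
  unfold qWV; ring

/-- **THE GÅRDING INEQUALITY WITH CURVATURE REMAINDER**: for UNITARY transports with plaquette defect `≤ p`, (GF0) and the DISPLAYED divergence control (GF3)
`n^{−d}(n²·divSq) ≤ C_D·ScV + C_D′·nsqV (Q W)`:  `n^{−d}(n²·roughV R W) ≤ (1 + C_D)·ScV W + C_D′·nsqV (Q W) + d·(n²p)·qWV W`. [folklore] -/
theorem garding_remainder {R : Tor (fine n M) → Fin d → (E →L[ℂ] E)} (hU : ∀ x μ, R x μ ∈ unitary (E →L[ℂ] E)) {p : ℝ} (hp : 0 ≤ p)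
    (hP : ∀ x μ ν, ‖R x μ * R (x + unitVec (fine n M) μ) ν - R x ν * R (x + unitVec (fine n M) ν) μ‖ ≤ p)
    {G : (Tor (fine n M) → Fin d → E) → ℝ} (hG0 : ∀ W, 0 ≤ G W) {Q : (Tor (fine n M) → Fin d → E) → (Tor M → Fin d → E)} {CD CD' : ℝ}
    (hGdiv : ∀ W, ((n : ℝ) ^ d)⁻¹ * ((n : ℝ) ^ 2 * divSq (fine n M) R W) ≤ CD * ScV n M R G W + CD' * nsqV M (Q W))
    (W : Tor (fine n M) → Fin d → E) :
    ((n : ℝ) ^ d)⁻¹ * ((n : ℝ) ^ 2 * roughV n M R W)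
      ≤ (1 + CD) * ScV n M R G W + CD' * nsqV M (Q W) + d * ((n : ℝ) ^ 2 * p) * qWV n M W := by
  have hnd : (0 : ℝ) ≤ ((n : ℝ) ^ d)⁻¹ * (n : ℝ) ^ 2 := by positivity
  have hW := roughV_le_curl_div n M hU hp hP W
  have hcurl := phys_curl_le_ScV n M R hG0 W
  have hdiv := hGdiv W
  have hq : ((n : ℝ) ^ d)⁻¹ * ((n : ℝ) ^ 2 * (d * p * nsqV (fine n M) W)) = d * ((n : ℝ) ^ 2 * p) * qWV n M W := by
    rw [phys_nsqV_eq]; ring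
  calc ((n : ℝ) ^ d)⁻¹ * ((n : ℝ) ^ 2 * roughV n M R W)
      ≤ ((n : ℝ) ^ d)⁻¹ * ((n : ℝ) ^ 2 * (curlSq (fine n M) R W / 2 + divSq (fine n M) R W + d * p * nsqV (fine n M) W)) := by
        rw [← mul_assoc, ← mul_assoc]; exact mul_le_mul_of_nonneg_left hW hnd
    _ = ((n : ℝ) ^ d)⁻¹ * ((n : ℝ) ^ 2 * (curlSq (fine n M) R W / 2)) + ((n : ℝ) ^ d)⁻¹ * ((n : ℝ) ^ 2 * divSq (fine n M) R W)
        + ((n : ℝ) ^ d)⁻¹ * ((n : ℝ) ^ 2 * (d * p * nsqV (fine n M) W)) := by ring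
    _ ≤ ScV n M R G W + (CD * ScV n M R G W + CD' * nsqV M (Q W)) + d * ((n : ℝ) ^ 2 * p) * qWV n M W := by
        rw [hq]; exact add_le_add (add_le_add hcurl hdiv) le_rfl
    _ = _ := by ring

/-! ## §2 (Går) from any rough Poincaré inequality, and the `hPc` binder -/

/-- **(Går) — THE GÅRDING INEQUALITY FOR THE VECTOR FORM**: with, in addition, ANY rough Poincaré inequality `qWV W ≤ A·nsqV (Q W) + B·n^{−d}(n²·roughV R W)`
(leaf-01-g5's `qWV_le_line_poincare`: `A = 16`, `B = 20` for the line-sum average) and the plaquette class `2·B·d·(n²p) ≤ 1`, the curvature remainder is absorbed: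
`n^{−d}(n²·roughV R W) ≤ 2(1 + C_D)·ScV W + 2(C_D′ + d(n²p)·A)·nsqV (Q W)`. [folklore] -/
theorem garding_of_poincare {R : Tor (fine n M) → Fin d → (E →L[ℂ] E)} (hU : ∀ x μ, R x μ ∈ unitary (E →L[ℂ] E)) {p : ℝ} (hp : 0 ≤ p)
    (hP : ∀ x μ ν, ‖R x μ * R (x + unitVec (fine n M) μ) ν - R x ν * R (x + unitVec (fine n M) ν) μ‖ ≤ p)
    {G : (Tor (fine n M) → Fin d → E) → ℝ} (hG0 : ∀ W, 0 ≤ G W) {Q : (Tor (fine n M) → Fin d → E) → (Tor M → Fin d → E)} {CD CD' : ℝ}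
    (hGdiv : ∀ W, ((n : ℝ) ^ d)⁻¹ * ((n : ℝ) ^ 2 * divSq (fine n M) R W) ≤ CD * ScV n M R G W + CD' * nsqV M (Q W))
    {A B : ℝ} (hPoinc : ∀ W, qWV n M W ≤ A * nsqV M (Q W) + B * (((n : ℝ) ^ d)⁻¹ * ((n : ℝ) ^ 2 * roughV n M R W)))
    (hsmall : 2 * B * (d * ((n : ℝ) ^ 2 * p)) ≤ 1) (W : Tor (fine n M) → Fin d → E) :
    ((n : ℝ) ^ d)⁻¹ * ((n : ℝ) ^ 2 * roughV n M R W)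
      ≤ 2 * (1 + CD) * ScV n M R G W + 2 * (CD' + d * ((n : ℝ) ^ 2 * p) * A) * nsqV M (Q W) := by
  set X := ((n : ℝ) ^ d)⁻¹ * ((n : ℝ) ^ 2 * roughV n M R W) with hX
  set ε := (d : ℝ) * ((n : ℝ) ^ 2 * p) with hε
  have hX0 : 0 ≤ X := by have := roughV_nonneg n M R W; positivity
  have hε0 : 0 ≤ ε := by positivity
  have h1 := garding_remainder n M hU hp hP hG0 hGdiv W
  rw [← hX] at h1
  have h2 : ε * qWV n M W ≤ ε * (A * nsqV M (Q W) + B * X) := mul_le_mul_of_nonneg_left (hPoinc W) hε0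
  have h3 : ε * B * X ≤ X / 2 := by
    have : ε * B * X = (2 * B * ε) * X / 2 := by ring
    rw [this]
    exact div_le_div_of_nonneg_right (by nlinarith [mul_le_mul_of_nonneg_right hsmall hX0]) zero_le_two
  nlinarith [h1, h2, h3]

/-- **THE `hPc` BINDER FROM (GF3) AND A ROUGH POINCARÉ INEQUALITY**: `qWV W ≤ max(B·κ, A + B·κ′)·(ScV W + nsqV (Q W))`, `κ = 2(1 + C_D)`, `κ′ = 2(C_D′ + d(n²p)A)`
— the V-P socket of `VariationalVectorForm.vector_pair_bracket_sqrt` for the pair `(ScV n M R G, Q)`. [folklore] -/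
theorem qWV_le_of_poincare_divControl {R : Tor (fine n M) → Fin d → (E →L[ℂ] E)} (hU : ∀ x μ, R x μ ∈ unitary (E →L[ℂ] E)) {p : ℝ} (hp : 0 ≤ p)
    (hP : ∀ x μ ν, ‖R x μ * R (x + unitVec (fine n M) μ) ν - R x ν * R (x + unitVec (fine n M) ν) μ‖ ≤ p)
    {G : (Tor (fine n M) → Fin d → E) → ℝ} (hG0 : ∀ W, 0 ≤ G W) {Q : (Tor (fine n M) → Fin d → E) → (Tor M → Fin d → E)} {CD CD' : ℝ}
    (hGdiv : ∀ W, ((n : ℝ) ^ d)⁻¹ * ((n : ℝ) ^ 2 * divSq (fine n M) R W) ≤ CD * ScV n M R G W + CD' * nsqV M (Q W))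
    {A B : ℝ} (hB : 0 ≤ B) (hPoinc : ∀ W, qWV n M W ≤ A * nsqV M (Q W) + B * (((n : ℝ) ^ d)⁻¹ * ((n : ℝ) ^ 2 * roughV n M R W)))
    (hsmall : 2 * B * (d * ((n : ℝ) ^ 2 * p)) ≤ 1) (W : Tor (fine n M) → Fin d → E) :
    qWV n M W ≤ max (B * (2 * (1 + CD))) (A + B * (2 * (CD' + d * ((n : ℝ) ^ 2 * p) * A))) * (ScV n M R G W + nsqV M (Q W)) := by
  set κ := 2 * (1 + CD) with hκ
  set κ' := 2 * (CD' + d * ((n : ℝ) ^ 2 * p) * A) with hκ'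
  have hG := garding_of_poincare n M hU hp hP hG0 hGdiv hPoinc hsmall W
  have hS0 : 0 ≤ ScV n M R G W := ScV_nonneg n M R hG0 W
  have hN0 : 0 ≤ nsqV M (Q W) := nsqV_nonneg M _
  have hm1 : B * κ ≤ max (B * κ) (A + B * κ') := le_max_left _ _
  have hm2 : A + B * κ' ≤ max (B * κ) (A + B * κ') := le_max_right _ _
  calc qWV n M W ≤ A * nsqV M (Q W) + B * (((n : ℝ) ^ d)⁻¹ * ((n : ℝ) ^ 2 * roughV n M R W)) := hPoinc W
    _ ≤ A * nsqV M (Q W) + B * (κ * ScV n M R G W + κ' * nsqV M (Q W)) := by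
        have : κ * ScV n M R G W + κ' * nsqV M (Q W) = 2 * (1 + CD) * ScV n M R G W + 2 * (CD' + d * ((n : ℝ) ^ 2 * p) * A) * nsqV M (Q W) := by
          rw [hκ, hκ']
        rw [this]; exact add_le_add le_rfl (mul_le_mul_of_nonneg_left hG hB)
    _ = (B * κ) * ScV n M R G W + (A + B * κ') * nsqV M (Q W) := by ring
    _ ≤ max (B * κ) (A + B * κ') * ScV n M R G W + max (B * κ) (A + B * κ') * nsqV M (Q W) :=
        add_le_add (mul_le_mul_of_nonneg_right hm1 hS0) (mul_le_mul_of_nonneg_right hm2 hN0)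
    _ = _ := by ring

/-! ## §3 The road's case: the line-indexed average `QvL (lineT T′ R)` (V-P CORE (i) BY NAME) -/

/-- **LEAF V-P FOR THE FIXED FORM, MODULO THE DIVERGENCE CONTROL (GF3)**: finite-dimensional Hilbert `E`; UNITARY site transports `T′` and bond transports `R`
with the in-block defect `‖R(x,μ)∘T′(x+e_μ)⋆∘T′(x) − 1‖ ≤ w`, `2d(nw)² ≤ ½` (V-COL-P's ∕ V-P CORE (i)'s binders verbatim), plaquette defect `≤ p` with
`40·d·(n²p) ≤ 1`, (GF0), (GF3) for `Q = QvL n M (lineT T′ R)`:  `qWV n M W ≤ max(40(1 + C_D), 16 + 40(C_D′ + 16·d·(n²p)))·(ScV W + nsqV (QvL (lineT T′ R) W))`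
(leaf-01-g5's `qWV_le_of_garding` fed with (Går) = `garding_of_poincare` over `qWV_le_line_poincare`, A = 16, B = 20). [folklore] -/
theorem qWV_le_line_of_divControl [FiniteDimensional ℂ E] {T' : Tor (fine n M) → (E →L[ℂ] E)} {R : Tor (fine n M) → Fin d → (E →L[ℂ] E)}
    (hT' : ∀ x, T' x ∈ unitary (E →L[ℂ] E)) (hU : ∀ x μ, R x μ ∈ unitary (E →L[ℂ] E)) {w : ℝ}
    (hw : ∀ (x : Tor (fine n M)) (μ : Fin d), blockOf n M (x + unitVec (fine n M) μ) = blockOf n M x →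
      ‖R x μ * star (T' (x + unitVec (fine n M) μ)) * T' x - 1‖ ≤ w)
    (hsmallw : 2 * (d : ℝ) * ((n : ℝ) * w) ^ 2 ≤ 1 / 2) {p : ℝ} (hp : 0 ≤ p)
    (hP : ∀ x μ ν, ‖R x μ * R (x + unitVec (fine n M) μ) ν - R x ν * R (x + unitVec (fine n M) ν) μ‖ ≤ p)
    (hsmallp : 40 * (d * ((n : ℝ) ^ 2 * p)) ≤ 1)
    {G : (Tor (fine n M) → Fin d → E) → ℝ} (hG0 : ∀ W, 0 ≤ G W) {CD CD' : ℝ}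
    (hGdiv : ∀ W, ((n : ℝ) ^ d)⁻¹ * ((n : ℝ) ^ 2 * divSq (fine n M) R W) ≤ CD * ScV n M R G W + CD' * nsqV M (QvL n M (lineT n M T' R) W))
    (W : Tor (fine n M) → Fin d → E) :
    qWV n M W ≤ max (20 * (2 * (1 + CD))) (16 + 20 * (2 * (CD' + d * ((n : ℝ) ^ 2 * p) * 16)))
      * (ScV n M R G W + nsqV M (QvL n M (lineT n M T' R) W)) := by
  have hR1 : ∀ x μ, ‖R x μ‖ ≤ 1 := fun x μ => opNorm_le_one_of_mem_unitary (hU x μ)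
  have hPoinc := qWV_le_line_poincare n M hT' hR1 hw hsmallw
  have hsmall : 2 * (20 : ℝ) * (d * ((n : ℝ) ^ 2 * p)) ≤ 1 := by linarith
  have hGar := fun W => garding_of_poincare n M hU hp hP hG0 hGdiv hPoinc hsmall W
  exact qWV_le_of_garding n M hT' hR1 hw hsmallw hG0 hGar W

/-! ## §4 The inhabitant of (GF3): the Landau ∕ penalty gauge functional `δ⁻¹·divSq` -/

section Landau
variable {N : Fin d → ℕ} [∀ μ, NeZero (N μ)]

/-- **THE LANDAU ∕ PENALTY GAUGE FUNCTIONAL** `landauG δ R W := δ⁻¹·divSq R W` (the `δ⁻¹‖div_U W‖²` of the skeleton's V-P row; lattice units; transports DATA).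
[folklore] -/
def landauG (N : Fin d → ℕ) [∀ μ, NeZero (N μ)] (δ : ℝ) (R : Tor N → Fin d → (E →L[ℂ] E)) (W : Tor N → Fin d → E) : ℝ := δ⁻¹ * divSq N R W

/-- (GF0): `0 ≤ landauG δ R W` for `0 ≤ δ`. [folklore] -/
theorem landauG_nonneg {δ : ℝ} (hδ : 0 ≤ δ) (R : Tor N → Fin d → (E →L[ℂ] E)) (W : Tor N → Fin d → E) : 0 ≤ landauG N δ R W :=
  mul_nonneg (inv_nonneg.mpr hδ) (divSq_nonneg N R W)

/-- continuity of the Landau functional (the `hGc` binder of the bracket). [folklore] -/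
theorem continuous_landauG (δ : ℝ) (R : Tor N → Fin d → (E →L[ℂ] E)) : Continuous (landauG N δ R) :=
  continuous_const.mul (continuous_divSq N R)

end Landau

/-- (GF1) for the Landau functional, UNITARY transports: `landauG δ R W ≤ (d∕δ)·roughV n M R W + 0·nsqV W` (file 1's `divSq ≤ d·roughV`). [folklore] -/
theorem landauG_le {R : Tor (fine n M) → Fin d → (E →L[ℂ] E)} (hU : ∀ x μ, R x μ ∈ unitary (E →L[ℂ] E)) {δ : ℝ} (hδ : 0 < δ)
    (W : Tor (fine n M) → Fin d → E) :
    landauG (fine n M) δ R W ≤ d / δ * roughV n M R W + 0 * nsqV (fine n M) W := by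
  have h := divSq_le_mul_roughV n M hU W
  unfold landauG
  rw [zero_mul, add_zero, div_eq_mul_inv, mul_comm (d : ℝ), mul_assoc]
  exact mul_le_mul_of_nonneg_left h (inv_nonneg.mpr hδ.le)

/-- **(GF3) FOR THE LANDAU FUNCTIONAL, EVERY AVERAGING `Q`**: `n^{−d}(n²·divSq R W) ≤ δ·ScV n M R (landauG δ R) W + 0·nsqV (Q W)`. [folklore] -/
theorem divControl_landauG (R : Tor (fine n M) → Fin d → (E →L[ℂ] E)) {δ : ℝ} (hδ : 0 < δ)
    (Q : (Tor (fine n M) → Fin d → E) → (Tor M → Fin d → E)) (W : Tor (fine n M) → Fin d → E) :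
    ((n : ℝ) ^ d)⁻¹ * ((n : ℝ) ^ 2 * divSq (fine n M) R W) ≤ δ * ScV n M R (landauG (fine n M) δ R) W + 0 * nsqV M (Q W) := by
  have hc := curlSq_nonneg (fine n M) R W
  have hnd : (0 : ℝ) ≤ ((n : ℝ) ^ d)⁻¹ * (n : ℝ) ^ 2 := by positivity
  have key : δ * ScV n M R (landauG (fine n M) δ R) W
      = ((n : ℝ) ^ d)⁻¹ * (n : ℝ) ^ 2 * (δ * (curlSq (fine n M) R W / 2)) + ((n : ℝ) ^ d)⁻¹ * ((n : ℝ) ^ 2 * divSq (fine n M) R W) := by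
    calc δ * ScV n M R (landauG (fine n M) δ R) W
        = ((n : ℝ) ^ d)⁻¹ * (n : ℝ) ^ 2 * (δ * (curlSq (fine n M) R W / 2))
          + (δ * δ⁻¹) * (((n : ℝ) ^ d)⁻¹ * ((n : ℝ) ^ 2 * divSq (fine n M) R W)) := by unfold ScV landauG; ring
      _ = _ := by rw [mul_inv_cancel₀ hδ.ne', one_mul]
  rw [zero_mul, add_zero, key]
  have : 0 ≤ ((n : ℝ) ^ d)⁻¹ * (n : ℝ) ^ 2 * (δ * (curlSq (fine n M) R W / 2)) := by positivity
  linarith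

/-- **(GF3) IS MONOTONE IN THE FUNCTIONAL**: if `G₁` satisfies (GF3) with `(C_D, C_D′)`, `0 ≤ C_D`, and `G₁ ≤ G₂` pointwise, so does `G₂` (e.g. the Landau
functional plus any nonnegative zeroth-order coupling). [folklore] -/
theorem divControl_mono {R : Tor (fine n M) → Fin d → (E →L[ℂ] E)} {G₁ G₂ : (Tor (fine n M) → Fin d → E) → ℝ} (h12 : ∀ W, G₁ W ≤ G₂ W)
    {Q : (Tor (fine n M) → Fin d → E) → (Tor M → Fin d → E)} {CD CD' : ℝ} (hCD : 0 ≤ CD)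
    (hGdiv : ∀ W, ((n : ℝ) ^ d)⁻¹ * ((n : ℝ) ^ 2 * divSq (fine n M) R W) ≤ CD * ScV n M R G₁ W + CD' * nsqV M (Q W))
    (W : Tor (fine n M) → Fin d → E) :
    ((n : ℝ) ^ d)⁻¹ * ((n : ℝ) ^ 2 * divSq (fine n M) R W) ≤ CD * ScV n M R G₂ W + CD' * nsqV M (Q W) := by
  have hmono : ScV n M R G₁ W ≤ ScV n M R G₂ W := by
    have := h12 W
    unfold ScV; gcongr
  exact (hGdiv W).trans (add_le_add (mul_le_mul_of_nonneg_left hmono hCD) le_rfl)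

/-- **(Går) FOR THE LANDAU FORM, ANY AVERAGING with a rough Poincaré inequality**:
`n^{−d}(n²·roughV R W) ≤ 2(1 + δ)·ScV n M R (landauG δ R) W + 2·d(n²p)·A·nsqV (Q W)`. [folklore] -/
theorem garding_landau {R : Tor (fine n M) → Fin d → (E →L[ℂ] E)} (hU : ∀ x μ, R x μ ∈ unitary (E →L[ℂ] E)) {p : ℝ} (hp : 0 ≤ p)
    (hP : ∀ x μ ν, ‖R x μ * R (x + unitVec (fine n M) μ) ν - R x ν * R (x + unitVec (fine n M) ν) μ‖ ≤ p) {δ : ℝ} (hδ : 0 < δ)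
    {Q : (Tor (fine n M) → Fin d → E) → (Tor M → Fin d → E)} {A B : ℝ}
    (hPoinc : ∀ W, qWV n M W ≤ A * nsqV M (Q W) + B * (((n : ℝ) ^ d)⁻¹ * ((n : ℝ) ^ 2 * roughV n M R W)))
    (hsmall : 2 * B * (d * ((n : ℝ) ^ 2 * p)) ≤ 1) (W : Tor (fine n M) → Fin d → E) :
    ((n : ℝ) ^ d)⁻¹ * ((n : ℝ) ^ 2 * roughV n M R W)
      ≤ 2 * (1 + δ) * ScV n M R (landauG (fine n M) δ R) W + 2 * (0 + d * ((n : ℝ) ^ 2 * p) * A) * nsqV M (Q W) :=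
  garding_of_poincare n M hU hp hP (landauG_nonneg hδ.le R) (divControl_landauG n M R hδ Q) hPoinc hsmall W

/-- **LEAF V-P CLOSED FOR THE LANDAU FORM AND THE ROAD's LINE-SUM AVERAGE**: finite-dimensional Hilbert `E`; UNITARY `T′`, `R`; in-block defect class
`2d(nw)² ≤ ½`; plaquette class `40·d·(n²p) ≤ 1`; `0 < δ`:
`qWV n M W ≤ max(40(1 + δ), 16 + 40(0 + 16·d·(n²p)))·(ScV n M R (landauG δ R) W + nsqV M (QvL n M (lineT T′ R) W))` — the `hPc` binder of
`vector_pair_bracket_sqrt` for `Sc := ScV n M R (landauG δ R)`, `Qk := QvL n M (lineT T′ R)`, NO functional hypothesis left. [folklore] -/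
theorem qWV_le_line_landau [FiniteDimensional ℂ E] {T' : Tor (fine n M) → (E →L[ℂ] E)} {R : Tor (fine n M) → Fin d → (E →L[ℂ] E)}
    (hT' : ∀ x, T' x ∈ unitary (E →L[ℂ] E)) (hU : ∀ x μ, R x μ ∈ unitary (E →L[ℂ] E)) {w : ℝ}
    (hw : ∀ (x : Tor (fine n M)) (μ : Fin d), blockOf n M (x + unitVec (fine n M) μ) = blockOf n M x →
      ‖R x μ * star (T' (x + unitVec (fine n M) μ)) * T' x - 1‖ ≤ w)
    (hsmallw : 2 * (d : ℝ) * ((n : ℝ) * w) ^ 2 ≤ 1 / 2) {p : ℝ} (hp : 0 ≤ p)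
    (hP : ∀ x μ ν, ‖R x μ * R (x + unitVec (fine n M) μ) ν - R x ν * R (x + unitVec (fine n M) ν) μ‖ ≤ p)
    (hsmallp : 40 * (d * ((n : ℝ) ^ 2 * p)) ≤ 1) {δ : ℝ} (hδ : 0 < δ) (W : Tor (fine n M) → Fin d → E) :
    qWV n M W ≤ max (20 * (2 * (1 + δ))) (16 + 20 * (2 * (0 + d * ((n : ℝ) ^ 2 * p) * 16)))
      * (ScV n M R (landauG (fine n M) δ R) W + nsqV M (QvL n M (lineT n M T' R) W)) :=
  qWV_le_line_of_divControl n M hT' hU hw hsmallw hp hP hsmallp (landauG_nonneg hδ.le R) (divControl_landauG n M R hδ _) W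

end Summit.QuantumFields.BalabanUV.T4Continuum.VariationalVectorGarding

end
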